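import Summits.QuantumFields.BalabanUV.Beta.FP.PerfectPropagatorLegDataInvSq

/-!
# `BalabanUV.Beta.FP.PerfectPropagatorLegDataFree` — road «FP» for binder row D1, leaf (H2) of the horizontal route, row **H2-ASM-2** (H2V-DESIGN §4,
# R-FP-23; `LEAVES-FP.md` l.323), PART 1b [folklore, generic]: SECOND AND THIRD LATTICE DIFFERENCES OF A `TwoPower` LEG FAMILY WITH SHARP FIRST
# DIFFERENCES — the dictionary `Δ_μΔ_ν g = c₄·∂_μ∂_ν|x|⁻² + O(‖w‖∞⁻⁵)` for EVERY pair `(μ, ν)`, the all-`w` letters `|Δ_μΔ_ν g| ≤ C₂∕(‖w‖∞+1)⁴`,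
# `|Δ_kΔ_μΔ_ν g| ≤ C₃∕(‖w‖∞+1)⁵`, the first-difference dictionary against `∂_i|x|⁻²` — UNCONDITIONALLY for the free leg `latticeGreen∕2`.

HONEST DEPENDENCY (page 1, mandatory): continuum YM on T⁴ ⇐ BetaPertH ∧ nine spine estimates (0/9 proved); BetaPertH ⇐ (D1) ∧ (D4) ∧ CAP+tail;
G-an2-4 gates asym, D1 and NE2/3/4.  HONEST FRAMING (cell contract, verbatim): «discharging `BetaPertH` makes Bałaban's UV stability UNCONDITIONAL —
a real constructive-QFT result; it is NOT the continuum limit and NOT the Clay problem.»  THIS MODULE DISCHARGES NOTHING of the wall: [folklore]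
bookkeeping over an3-g5's `TwoPowerLegs` (structure `TwoPower`, predicate `SharpDiff`, `abs_hessInvSq_le`, the free instance `free`∕`free_sharp` = lit1's
Lawler–Limic kernel theorems through the tree) and PART 1a.  Every statement is about an ARBITRARY family `T : TwoPower` with `SharpDiff T B₃`; the free Green
function enters only through `TwoPowerLegs.free`.  One [folklore] constant def (`B3free` = the tree's sharp constant, chosen once); 0 `def … : Prop`; nothing cited;
0 sorry; 0 wall binders; NOT `hgerm`, NOT D1, NOT BetaPertH, NOT continuum, NOT Clay.

ABSOLUTE RULE (cell charter, verbatim): «No internally-minted statement may enter as a cited fact. Every hypothesis is either kernel-proved in this package or a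
verbatim quotation of a PUBLISHED theorem with page reference. The manuscript(s) under audit are NOT citable for their own disputed steps — they are the thing
under adjudication; programme-internal (2001/route/tribunal) claims are never citable.»

WHAT (`g = T.g L k`, `w ∈ ℤ⁴`, `e_μ = unitVec μ`, `X = toReal w`, `U = T.U`):
* §4 [folklore] `sharp_at_shift`; **`abs_diff2_sub_hess_le`** (`4 ≤ ‖w‖∞`, every `μ ν`: `|Δ_μΔ_ν g(w) − c₄·∂_μ∂_ν|X|⁻²| ≤ (64B₃ + 89088c₄)∕‖w‖∞⁵`);
  **`abs_diff2_le`** (every `w`: `≤ (2⁴(64B₃ + 89098c₄) + 5⁴·4U)∕(‖w‖∞+1)⁴`); `abs_diff3_le_far` (`6 ≤ ‖w‖∞`: `≤ (128B₃ + 701568c₄)∕‖w‖∞⁵`);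
  **`abs_diff3_le`** (every `w`: `≤ (2⁵(128B₃ + 701568c₄) + 7⁵·8U)∕(‖w‖∞+1)⁵`); **`abs_diff1_sub_d1_le`** (`2 ≤ ‖w‖∞`: `|Δ_i g − c₄·∂_i|X|⁻²| ≤ (B₃ + 112c₄)∕‖w‖∞⁴`).
* §5 [folklore] the FREE instances (`g = latticeGreen∕2`, `B3free`): `free_diff2_sub_hess_le`, `free_diff2_le`, `free_diff3_le`, `free_diff1_sub_d1_le`.
Consumer: PART 2 `FP/PerfectPropagatorLegData` (adds the remainder `Re KB` of H2-P-KER (K1)–(K3); states the letters ∕ dictionary of `P = Re PinfKer`).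

Provenance: binder row D1 formalisation swarm, lineage beta-d1-formalise-leaf-01, gen 9 (prover-b2b-balaban-beta-d1-formalise-leaf-01-g9-0), 2026-08-20;
road FP (owner b2b-balaban-beta-d1-p3, H2V-DESIGN f78878bd5f8d2d18), row H2-ASM-2; INTENT ∕ CLAIM journal l.23258.
-/

noncomputable section

namespace Summit.QuantumFields.BalabanUV.Beta.FP.PerfectPropagatorLegDataFree

open Finset
open scoped BigOperators
open Literature.Probability.LatticeModels (latticeGreen)
open Literature.MathematicalPhysics.QuantumFieldTheory.Balaban1983to89.Beta
open Literature.MathematicalPhysics.QuantumFieldTheory.Balaban1983to89.Beta.TransverseStructure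
open Literature.MathematicalPhysics.QuantumFieldTheory.Balaban1983to89.Beta.LeadingCoefficient
open Literature.MathematicalPhysics.QuantumFieldTheory.Balaban1983to89.Beta.DyadicShell
open Literature.MathematicalPhysics.QuantumFieldTheory.Balaban1983to89.Beta.BubbleTransfer
open Literature.MathematicalPhysics.QuantumFieldTheory.Balaban1983to89.Beta.TwoPowerLegs
open Summit.QuantumFields.BalabanUV.Beta.FP.PerfectPropagatorLegDataInvSq

/-! ## §4 Second and third differences of a `TwoPower` family with sharp first differences -/

section TwoPowerSharp

variable (T : TwoPower) {B₃ : ℝ} (hB : 0 ≤ B₃) (hS : SharpDiff T B₃) (L k : ℕ)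

include hB hS in
/-- [folklore] the sharp first-difference error `g(x+e_ν) − g(x) − c₄(invSq(x+e_ν) − invSq x)` at a point of norm `≥ ‖w‖∞∕2` (`2 ≤ ‖w‖∞`). -/
theorem sharp_at_shift {w x : Pt} (hw : 2 ≤ supNorm w) (hx : (supNorm w : ℝ) / 2 ≤ supNorm x) (ν : Fin 4) :
    |T.g L k (x + unitVec ν) - T.g L k x - c4 * (invSq (toReal (x + unitVec ν)) - invSq (toReal x))| ≤ 32 * B₃ / (supNorm w : ℝ) ^ 5 := by
  have hs2 : (2 : ℝ) ≤ supNorm w := by exact_mod_cast hw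
  have hspos : (0 : ℝ) < supNorm w := by linarith
  have hx0 : x ≠ 0 := by
    intro h; rw [h, supNorm_eq_zero_iff.mpr rfl] at hx; norm_num at hx; linarith
  exact (hS L k x hx0 ν).trans (div_pow_five_shift_le hB hspos hx)

include hB hS in
/-- [folklore] **SECOND DIFFERENCES vs THE HESSIAN ENTRY** (`4 ≤ ‖w‖∞`, every `μ ν`):
`|Δ_μΔ_ν g(w) − c₄·∂_μ∂_ν|X|⁻²| ≤ (64·B₃ + 89088·c₄)∕‖w‖∞⁵`. -/
theorem abs_diff2_sub_hess_le (μ ν : Fin 4) {w : Pt} (hw : 4 ≤ supNorm w) :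
    |T.g L k (w + unitVec μ + unitVec ν) - T.g L k (w + unitVec μ) - T.g L k (w + unitVec ν) + T.g L k w
        - c4 * hessInvSq μ ν (toReal w)| ≤ (64 * B₃ + 89088 * c4) / (supNorm w : ℝ) ^ 5 := by
  have hs4 : (4 : ℝ) ≤ supNorm w := by exact_mod_cast hw
  have hc := c4_pos
  have hD1 := sharp_at_shift T hB hS L k (w := w) (x := w + unitVec μ) (by omega)
    (half_le_supNorm_add_of (r := 1) (by rw [supNorm_unitVec]; norm_num) (by linarith)) ν
  have hD2 := sharp_at_shift T hB hS L k (w := w) (x := w) (by omega) (by linarith) ν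
  have hH := abs_diff2_invSq_sub_hess_le (w := w) μ ν hw
  have hH' : |c4 * (invSq (toReal (w + unitVec μ + unitVec ν)) - invSq (toReal (w + unitVec μ)) - invSq (toReal (w + unitVec ν))
      + invSq (toReal w) - hessInvSq μ ν (toReal w))| ≤ c4 * (89088 / (supNorm w : ℝ) ^ 5) := by
    rw [abs_mul, abs_of_pos hc]; exact mul_le_mul_of_nonneg_left hH hc.le
  have e : T.g L k (w + unitVec μ + unitVec ν) - T.g L k (w + unitVec μ) - T.g L k (w + unitVec ν) + T.g L k w - c4 * hessInvSq μ ν (toReal w)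
      = (T.g L k (w + unitVec μ + unitVec ν) - T.g L k (w + unitVec μ)
            - c4 * (invSq (toReal (w + unitVec μ + unitVec ν)) - invSq (toReal (w + unitVec μ))))
        - (T.g L k (w + unitVec ν) - T.g L k w - c4 * (invSq (toReal (w + unitVec ν)) - invSq (toReal w)))
        + c4 * (invSq (toReal (w + unitVec μ + unitVec ν)) - invSq (toReal (w + unitVec μ)) - invSq (toReal (w + unitVec ν))
            + invSq (toReal w) - hessInvSq μ ν (toReal w)) := by ring
  rw [e]
  have b1 := abs_le.mp hD1; have b2 := abs_le.mp hD2; have b3 := abs_le.mp hH'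
  have hsum : |(T.g L k (w + unitVec μ + unitVec ν) - T.g L k (w + unitVec μ)
            - c4 * (invSq (toReal (w + unitVec μ + unitVec ν)) - invSq (toReal (w + unitVec μ))))
        - (T.g L k (w + unitVec ν) - T.g L k w - c4 * (invSq (toReal (w + unitVec ν)) - invSq (toReal w)))
        + c4 * (invSq (toReal (w + unitVec μ + unitVec ν)) - invSq (toReal (w + unitVec μ)) - invSq (toReal (w + unitVec ν))
            + invSq (toReal w) - hessInvSq μ ν (toReal w))|
      ≤ 32 * B₃ / (supNorm w : ℝ) ^ 5 + 32 * B₃ / (supNorm w : ℝ) ^ 5 + c4 * (89088 / (supNorm w : ℝ) ^ 5) := by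
    rw [abs_le]; constructor <;> linarith [b1.1, b1.2, b2.1, b2.2, b3.1, b3.2]
  exact hsum.trans (le_of_eq (by ring))

include hB hS in
/-- [folklore] **ALL-`w` SECOND-DIFFERENCE LETTER**: `|Δ_μΔ_ν g(w)| ≤ (2⁴·(64B₃ + 89098c₄) + 5⁴·4U)∕(‖w‖∞+1)⁴` for every `w`, every `μ ν`. -/
theorem abs_diff2_le (μ ν : Fin 4) (w : Pt) :
    |T.g L k (w + unitVec μ + unitVec ν) - T.g L k (w + unitVec μ) - T.g L k (w + unitVec ν) + T.g L k w|
      ≤ (2 ^ 4 * (64 * B₃ + 89098 * c4) + ((4 : ℕ) + 1 : ℝ) ^ 4 * (4 * T.U)) / ((supNorm w : ℝ) + 1) ^ 4 := by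
  have hc := c4_pos
  have hU := T.nonneg_U
  refine abs_le_inv_succ_pow_of_far
    (f := fun w => T.g L k (w + unitVec μ + unitVec ν) - T.g L k (w + unitVec μ) - T.g L k (w + unitVec ν) + T.g L k w)
    (by positivity) (by positivity) (by norm_num) (fun x => ?_) (fun x hx => ?_) w
  · have h1 := abs_le.mp (T.bdd L k (x + unitVec μ + unitVec ν)); have h2 := abs_le.mp (T.bdd L k (x + unitVec μ))
    have h3 := abs_le.mp (T.bdd L k (x + unitVec ν)); have h4 := abs_le.mp (T.bdd L k x)
    rw [abs_le]; constructor <;> linarith [h1.1, h1.2, h2.1, h2.2, h3.1, h3.2, h4.1, h4.2]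
  · have hs4 : (4 : ℝ) ≤ supNorm x := by exact_mod_cast hx
    have hspos : (0 : ℝ) < supNorm x := by linarith
    have hx0 : x ≠ 0 := by intro h; rw [h, supNorm_eq_zero_iff.mpr rfl] at hx; omega
    have h := abs_diff2_sub_hess_le T hB hS L k μ ν hx
    have hH : |c4 * hessInvSq μ ν (toReal x)| ≤ c4 * (10 / (supNorm x : ℝ) ^ 4) := by
      rw [abs_mul, abs_of_pos hc]; exact mul_le_mul_of_nonneg_left (abs_hessInvSq_le μ ν hx0) hc.le
    have h5 : (64 * B₃ + 89088 * c4) / (supNorm x : ℝ) ^ 5 ≤ (64 * B₃ + 89088 * c4) / (supNorm x : ℝ) ^ 4 :=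
      div_le_div_of_nonneg_left (by positivity) (by positivity) (pow_le_pow_right₀ (by linarith) (by norm_num))
    have e : T.g L k (x + unitVec μ + unitVec ν) - T.g L k (x + unitVec μ) - T.g L k (x + unitVec ν) + T.g L k x
        = (T.g L k (x + unitVec μ + unitVec ν) - T.g L k (x + unitVec μ) - T.g L k (x + unitVec ν) + T.g L k x - c4 * hessInvSq μ ν (toReal x))
          + c4 * hessInvSq μ ν (toReal x) := by ring
    rw [e]
    have b1 := abs_le.mp (h.trans h5); have b2 := abs_le.mp hH
    have hsum : |(T.g L k (x + unitVec μ + unitVec ν) - T.g L k (x + unitVec μ) - T.g L k (x + unitVec ν) + T.g L k x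
          - c4 * hessInvSq μ ν (toReal x)) + c4 * hessInvSq μ ν (toReal x)|
        ≤ (64 * B₃ + 89088 * c4) / (supNorm x : ℝ) ^ 4 + c4 * (10 / (supNorm x : ℝ) ^ 4) := by
      rw [abs_le]; constructor <;> linarith [b1.1, b1.2, b2.1, b2.2]
    exact hsum.trans (le_of_eq (by ring))

include hB hS in
/-- [folklore] **THIRD DIFFERENCES, FAR FIELD** (`6 ≤ ‖w‖∞`): `|Δ_kΔ_μΔ_ν g(w)| ≤ (128·B₃ + 701568·c₄)∕‖w‖∞⁵`. -/
theorem abs_diff3_le_far (κ μ ν : Fin 4) {w : Pt} (hw : 6 ≤ supNorm w) :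
    |T.g L k (w + unitVec κ + unitVec μ + unitVec ν) - T.g L k (w + unitVec κ + unitVec μ) - T.g L k (w + unitVec κ + unitVec ν)
        - T.g L k (w + unitVec μ + unitVec ν) + T.g L k (w + unitVec κ) + T.g L k (w + unitVec μ) + T.g L k (w + unitVec ν) - T.g L k w|
      ≤ (128 * B₃ + 701568 * c4) / (supNorm w : ℝ) ^ 5 := by
  have hs6 : (6 : ℝ) ≤ supNorm w := by exact_mod_cast hw
  have hc := c4_pos
  have h2 : 2 ≤ supNorm w := by omega
  have hD12 := sharp_at_shift T hB hS L k (w := w) (x := w + unitVec κ + unitVec μ) h2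
    (by rw [add_assoc]; exact half_le_supNorm_add_of (supNorm_unitVec_add_le κ μ) (by linarith)) ν
  have hD1 := sharp_at_shift T hB hS L k (w := w) (x := w + unitVec κ) h2
    (half_le_supNorm_add_of (r := 1) (by rw [supNorm_unitVec]; norm_num) (by linarith)) ν
  have hD2 := sharp_at_shift T hB hS L k (w := w) (x := w + unitVec μ) h2
    (half_le_supNorm_add_of (r := 1) (by rw [supNorm_unitVec]; norm_num) (by linarith)) ν
  have hD0 := sharp_at_shift T hB hS L k (w := w) (x := w) h2 (by linarith) ν
  have hI := abs_diff3_invSq_le (w := w) κ μ ν hw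
  have hI' : |c4 * (invSq (toReal (w + unitVec κ + unitVec μ + unitVec ν)) - invSq (toReal (w + unitVec κ + unitVec μ))
        - invSq (toReal (w + unitVec κ + unitVec ν)) - invSq (toReal (w + unitVec μ + unitVec ν))
        + invSq (toReal (w + unitVec κ)) + invSq (toReal (w + unitVec μ)) + invSq (toReal (w + unitVec ν)) - invSq (toReal w))|
      ≤ c4 * (701568 / (supNorm w : ℝ) ^ 5) := by
    rw [abs_mul, abs_of_pos hc]; exact mul_le_mul_of_nonneg_left hI hc.le
  have e : T.g L k (w + unitVec κ + unitVec μ + unitVec ν) - T.g L k (w + unitVec κ + unitVec μ) - T.g L k (w + unitVec κ + unitVec ν)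
        - T.g L k (w + unitVec μ + unitVec ν) + T.g L k (w + unitVec κ) + T.g L k (w + unitVec μ) + T.g L k (w + unitVec ν) - T.g L k w
      = (T.g L k (w + unitVec κ + unitVec μ + unitVec ν) - T.g L k (w + unitVec κ + unitVec μ)
            - c4 * (invSq (toReal (w + unitVec κ + unitVec μ + unitVec ν)) - invSq (toReal (w + unitVec κ + unitVec μ))))
        - (T.g L k (w + unitVec κ + unitVec ν) - T.g L k (w + unitVec κ) - c4 * (invSq (toReal (w + unitVec κ + unitVec ν)) - invSq (toReal (w + unitVec κ))))
        - (T.g L k (w + unitVec μ + unitVec ν) - T.g L k (w + unitVec μ) - c4 * (invSq (toReal (w + unitVec μ + unitVec ν)) - invSq (toReal (w + unitVec μ))))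
        + (T.g L k (w + unitVec ν) - T.g L k w - c4 * (invSq (toReal (w + unitVec ν)) - invSq (toReal w)))
        + c4 * (invSq (toReal (w + unitVec κ + unitVec μ + unitVec ν)) - invSq (toReal (w + unitVec κ + unitVec μ))
            - invSq (toReal (w + unitVec κ + unitVec ν)) - invSq (toReal (w + unitVec μ + unitVec ν))
            + invSq (toReal (w + unitVec κ)) + invSq (toReal (w + unitVec μ)) + invSq (toReal (w + unitVec ν)) - invSq (toReal w)) := by ring
  rw [e]
  have b12 := abs_le.mp hD12; have b1 := abs_le.mp hD1; have b2 := abs_le.mp hD2; have b0 := abs_le.mp hD0; have bI := abs_le.mp hI'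
  have e2 : (128 * B₃ + 701568 * c4) / (supNorm w : ℝ) ^ 5
      = 32 * B₃ / (supNorm w : ℝ) ^ 5 + 32 * B₃ / (supNorm w : ℝ) ^ 5 + 32 * B₃ / (supNorm w : ℝ) ^ 5 + 32 * B₃ / (supNorm w : ℝ) ^ 5
        + c4 * (701568 / (supNorm w : ℝ) ^ 5) := by ring
  rw [e2, abs_le]
  constructor <;> linarith [b12.1, b12.2, b1.1, b1.2, b2.1, b2.2, b0.1, b0.2, bI.1, bI.2]

include hB hS in
/-- [folklore] **ALL-`w` THIRD-DIFFERENCE LETTER**: `|Δ_kΔ_μΔ_ν g(w)| ≤ (2⁵·(128B₃ + 701568c₄) + 7⁵·8U)∕(‖w‖∞+1)⁵` for every `w`, every `k μ ν`. -/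
theorem abs_diff3_le (κ μ ν : Fin 4) (w : Pt) :
    |T.g L k (w + unitVec κ + unitVec μ + unitVec ν) - T.g L k (w + unitVec κ + unitVec μ) - T.g L k (w + unitVec κ + unitVec ν)
        - T.g L k (w + unitVec μ + unitVec ν) + T.g L k (w + unitVec κ) + T.g L k (w + unitVec μ) + T.g L k (w + unitVec ν) - T.g L k w|
      ≤ (2 ^ 5 * (128 * B₃ + 701568 * c4) + ((6 : ℕ) + 1 : ℝ) ^ 5 * (8 * T.U)) / ((supNorm w : ℝ) + 1) ^ 5 := by
  have hc := c4_pos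
  have hU := T.nonneg_U
  refine abs_le_inv_succ_pow_of_far
    (f := fun w => T.g L k (w + unitVec κ + unitVec μ + unitVec ν) - T.g L k (w + unitVec κ + unitVec μ) - T.g L k (w + unitVec κ + unitVec ν)
        - T.g L k (w + unitVec μ + unitVec ν) + T.g L k (w + unitVec κ) + T.g L k (w + unitVec μ) + T.g L k (w + unitVec ν) - T.g L k w)
    (by positivity) (by positivity) (by norm_num) (fun x => ?_) (fun x hx => abs_diff3_le_far T hB hS L k κ μ ν hx) w
  have h1 := abs_le.mp (T.bdd L k (x + unitVec κ + unitVec μ + unitVec ν)); have h2 := abs_le.mp (T.bdd L k (x + unitVec κ + unitVec μ))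
  have h3 := abs_le.mp (T.bdd L k (x + unitVec κ + unitVec ν)); have h4 := abs_le.mp (T.bdd L k (x + unitVec μ + unitVec ν))
  have h5 := abs_le.mp (T.bdd L k (x + unitVec κ)); have h6 := abs_le.mp (T.bdd L k (x + unitVec μ))
  have h7 := abs_le.mp (T.bdd L k (x + unitVec ν)); have h8 := abs_le.mp (T.bdd L k x)
  rw [abs_le]
  constructor <;> linarith [h1.1, h1.2, h2.1, h2.2, h3.1, h3.2, h4.1, h4.2, h5.1, h5.2, h6.1, h6.2, h7.1, h7.2, h8.1, h8.2]

include hB hS in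
/-- [folklore] **FIRST DIFFERENCES vs THE FIRST PARTIAL** (`2 ≤ ‖w‖∞`): `|g(w+e_i) − g(w) − c₄·∂_i|X|⁻²| ≤ (B₃ + 112c₄)∕‖w‖∞⁴`. -/
theorem abs_diff1_sub_d1_le (i : Fin 4) {w : Pt} (hw : 2 ≤ supNorm w) :
    |T.g L k (w + unitVec i) - T.g L k w - c4 * d1InvSq i (toReal w)| ≤ (B₃ + 112 * c4) / (supNorm w : ℝ) ^ 4 := by
  have hw0 : w ≠ 0 := by intro h; rw [h, supNorm_eq_zero_iff.mpr rfl] at hw; omega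
  have hs2 : (2 : ℝ) ≤ supNorm w := by exact_mod_cast hw
  have hspos : (0 : ℝ) < supNorm w := by linarith
  have hc := c4_pos
  have hD := hS L k w hw0 i
  have hD' : |T.g L k (w + unitVec i) - T.g L k w - c4 * (invSq (toReal (w + unitVec i)) - invSq (toReal w))| ≤ B₃ / (supNorm w : ℝ) ^ 4 :=
    hD.trans (div_le_div_of_nonneg_left hB (by positivity) (pow_le_pow_right₀ (by linarith) (by norm_num)))
  have hT : |c4 * (invSq (toReal (w + unitVec i)) - invSq (toReal w) - d1InvSq i (toReal w))| ≤ c4 * (112 / (supNorm w : ℝ) ^ 4) := by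
    rw [abs_mul, abs_of_pos hc]; exact mul_le_mul_of_nonneg_left (abs_diff1_invSq_sub_d1_le (w := w) i hw) hc.le
  have e : T.g L k (w + unitVec i) - T.g L k w - c4 * d1InvSq i (toReal w)
      = (T.g L k (w + unitVec i) - T.g L k w - c4 * (invSq (toReal (w + unitVec i)) - invSq (toReal w)))
        + c4 * (invSq (toReal (w + unitVec i)) - invSq (toReal w) - d1InvSq i (toReal w)) := by ring
  rw [e]
  have b1 := abs_le.mp hD'; have b2 := abs_le.mp hT
  have hsum : |(T.g L k (w + unitVec i) - T.g L k w - c4 * (invSq (toReal (w + unitVec i)) - invSq (toReal w)))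
        + c4 * (invSq (toReal (w + unitVec i)) - invSq (toReal w) - d1InvSq i (toReal w))|
      ≤ B₃ / (supNorm w : ℝ) ^ 4 + c4 * (112 / (supNorm w : ℝ) ^ 4) := by
    rw [abs_le]; constructor <;> linarith [b1.1, b1.2, b2.1, b2.2]
  exact hsum.trans (le_of_eq (by ring))

end TwoPowerSharp

/-! ## §5 The free leg `latticeGreen∕2`, unconditionally -/

/-- [folklore] the tree's sharp constant of the free family (`TwoPowerLegs.free_sharp`), chosen once. -/
def B3free : ℝ := Classical.choose free_sharp

/-- [folklore] `0 ≤ B3free`. -/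
theorem B3free_nonneg : 0 ≤ B3free := (Classical.choose_spec free_sharp).1

/-- [folklore] the free family has sharp differences with constant `B3free`. -/
theorem free_sharpDiff : SharpDiff free B3free := (Classical.choose_spec free_sharp).2

/-- [folklore] **FREE SECOND DIFFERENCES vs THE HESSIAN** (`4 ≤ ‖w‖∞`, every `μ ν`):
`|Δ_μΔ_ν(G₀∕2)(w) − c₄·∂_μ∂_ν|X|⁻²| ≤ (64·B3free + 89088·c₄)∕‖w‖∞⁵`, `G₀ = latticeGreen`. -/
theorem free_diff2_sub_hess_le (μ ν : Fin 4) {w : Pt} (hw : 4 ≤ supNorm w) :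
    |latticeGreen (w + unitVec μ + unitVec ν) / 2 - latticeGreen (w + unitVec μ) / 2 - latticeGreen (w + unitVec ν) / 2 + latticeGreen w / 2
        - c4 * hessInvSq μ ν (toReal w)| ≤ (64 * B3free + 89088 * c4) / (supNorm w : ℝ) ^ 5 := by
  simpa using abs_diff2_sub_hess_le free B3free_nonneg free_sharpDiff 0 0 μ ν hw

/-- [folklore] **FREE SECOND-DIFFERENCE LETTER, every `w`, every `μ ν`**. -/
theorem free_diff2_le (μ ν : Fin 4) (w : Pt) :
    |latticeGreen (w + unitVec μ + unitVec ν) / 2 - latticeGreen (w + unitVec μ) / 2 - latticeGreen (w + unitVec ν) / 2 + latticeGreen w / 2|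
      ≤ (2 ^ 4 * (64 * B3free + 89098 * c4) + ((4 : ℕ) + 1 : ℝ) ^ 4 * (4 * free.U)) / ((supNorm w : ℝ) + 1) ^ 4 := by
  simpa using abs_diff2_le free B3free_nonneg free_sharpDiff 0 0 μ ν w

/-- [folklore] **FREE THIRD-DIFFERENCE LETTER, every `w`, every `k μ ν`**. -/
theorem free_diff3_le (κ μ ν : Fin 4) (w : Pt) :
    |latticeGreen (w + unitVec κ + unitVec μ + unitVec ν) / 2 - latticeGreen (w + unitVec κ + unitVec μ) / 2
        - latticeGreen (w + unitVec κ + unitVec ν) / 2 - latticeGreen (w + unitVec μ + unitVec ν) / 2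
        + latticeGreen (w + unitVec κ) / 2 + latticeGreen (w + unitVec μ) / 2 + latticeGreen (w + unitVec ν) / 2 - latticeGreen w / 2|
      ≤ (2 ^ 5 * (128 * B3free + 701568 * c4) + ((6 : ℕ) + 1 : ℝ) ^ 5 * (8 * free.U)) / ((supNorm w : ℝ) + 1) ^ 5 := by
  simpa using abs_diff3_le free B3free_nonneg free_sharpDiff 0 0 κ μ ν w

/-- [folklore] **FREE FIRST DIFFERENCES vs THE FIRST PARTIAL** (`2 ≤ ‖w‖∞`): `|Δ_i(G₀∕2)(w) − c₄·∂_i|X|⁻²| ≤ (B3free + 112c₄)∕‖w‖∞⁴`. -/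
theorem free_diff1_sub_d1_le (i : Fin 4) {w : Pt} (hw : 2 ≤ supNorm w) :
    |latticeGreen (w + unitVec i) / 2 - latticeGreen w / 2 - c4 * d1InvSq i (toReal w)| ≤ (B3free + 112 * c4) / (supNorm w : ℝ) ^ 4 := by
  simpa using abs_diff1_sub_d1_le free B3free_nonneg free_sharpDiff 0 0 i hw

end Summit.QuantumFields.BalabanUV.Beta.FP.PerfectPropagatorLegDataFree

end
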